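import Literature.NumberTheory.Automorphic.AshSmithTheoryHeckeLevelProofs
import HarnessLib

/-!
# Ash (2003), *Smith theory and Hecke operators* — proofs towards the named fact
# `Ash2003_inducedRayClassCharacter_attached`: the degree-`0` Hecke eigenclass `[1] ∈ H⁰(X(M), F)`

Topic `NumberTheory/Automorphic`; companion of `Literature.NumberTheory.Automorphic.AshSmithTheoryHecke`
(the named fact `Ash2003_inducedRayClassCharacter_attached` = A. Ash, *Smith theory and Hecke
operators*, J. Algebra **259** (2003) 43–58 [Ash2003], Thm. 1.1 / Cor. 4.4).  The automorphic half
of [Ash2003] asks for Hecke eigenclasses in `H^*(X(M), F)`, typed in the tree as the group cohomology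
`H^i(GL_n(ℚ)⁺, Fun(GL_n(𝔸_ℚ^∞) ⧸ K_f(M), F))` (`Ash2003.cohomology`) with the double-coset operators
`T_g = [K_f(M) g K_f(M)]` (`Ash2003.heckeT`).  This file produces the first honest eigenclass of that
module — the one every locally symmetric space has: **the constant function `1` in degree `0`**,

* `ArithmeticQuotient.heckeEnd_H0Iso_inv_constOne` (general level `L ≤ 𝒢`, any `ι : Γ →* 𝒢`, any
  commutative ring `k`): under `H⁰(X_L, k) ≅ Fun(𝒢 ⧸ L, k)^Γ` (Mathlib `groupCohomology.H0Iso`) the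
  class `[1]` of the constant function satisfies `T_g [1] = #(L g L / L) · [1]` whenever `L g L / L`
  is finite (`(T_g 1)(xL) = ∑_{hL ⊆ LgL} 1`; naturality of `H0Iso`,
  `groupCohomology.map_id_comp_H0Iso_hom`);
* `Ash2003.exists_isEigenclass_zero`: for `M ≠ 0` the class `[1] ∈ H⁰(X(M), F)` is a Hecke eigenclass
  in the sense of `Ash2003.IsEigenclass` (nonzero; eigenvalue of `T_{l,k}` = the number of single
  cosets in `K_f(M) s_{l,k} K_f(M)`, reduced into `F` — finite by
  `Ash2003.finite_doubleCosetQuot_finiteLevel` of `AshSmithTheoryHeckeLevelProofs`).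

This is the case `θ = 1` of [Ash2003] on the automorphic side, up to the classical count
`#(GL_n(ℤ_l) diag(l,…,l,1,…,1) GL_n(ℤ_l) / GL_n(ℤ_l)) = [n choose k]_l` (Gaussian binomial) and the
`q`-binomial identity `∑_k (-1)^k l^{k(k-1)/2} [n choose k]_l X^{n-k} = ∏_{j<n} (X - l^j)`, which
together with the Galois half (`Ash2003.exists_isAttached_induce_of_isGaloisAvatar`,
`AshSmithTheoryHeckeAttachedProofs`: `det(X - Ind(𝟙)(Frob_l)) = ∏_{w ∣ l} (X^f - 1) = ∏_{j<p-1} (X - l^j)`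
in characteristic `p`) would settle the fact for the trivial character; neither count is here.

## References

* A. Ash, *Smith theory and Hecke operators*, J. Algebra 259 (2003) 43–58, §2, Def. 0.1 [Ash2003].
* G. Shimura, *Introduction to the arithmetic theory of automorphic functions* (1971), Ch. 3 §3.1
  (`deg(Γ α Γ) = #(Γ \ Γ α Γ)` acting on constants) [ShimuraIATAF1971].
-/

noncomputable section

open CategoryTheory

universe u

namespace Literature.NumberTheory.Automorphic

namespace ArithmeticQuotient

variable (k : Type u) [CommRing k] {Γ 𝒢 : Type u} [Group Γ] [Group 𝒢] (ι : Γ →* 𝒢)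
  (L : Subgroup 𝒢)

/-- The constant function `1 ∈ Fun(𝒢 ⧸ L, k)` is `Γ`-invariant (`(γ • 1)(c) = 1`): it spans the
image of `H⁰(pt)` in `H⁰(X_L, k) = Fun(𝒢 ⧸ L, k)^Γ`. [folklore] -/
theorem constOne_mem_invariants :
    (fun _ : 𝒢 ⧸ L => (1 : k)) ∈ (coeffRepresentation k ι L k).invariants := fun _ => rfl

/-- **`T_g 1 = #(L g L / L) · 1` on functions**: the Hecke operator `[L g L]` multiplies the constant
function by the number of single cosets in the double coset (when finite; Shimura, Ch. 3 §3.1,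
`deg`). [folklore] -/
theorem heckeFun_constOne {g : 𝒢} (hfin : (doubleCosetQuot L g).Finite) :
    heckeFun k L g k (fun _ : 𝒢 ⧸ L => (1 : k)) = fun _ => (hfin.toFinset.card : k) := by
  classical
  funext c
  rw [heckeFun_apply, dif_pos hfin, Finset.sum_const, nsmul_eq_mul, mul_one]

/-- **`T_g [1] = #(L g L / L) · [1]` in `H⁰(X_L, k)`**: the degree-`0` class of the constant function
(transported along Mathlib's `groupCohomology.H0Iso : H⁰ ≅ invariants`) is an eigenvector of every
Hecke operator `T_g` with `L g L / L` finite, with eigenvalue the number of single cosets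
(naturality of `H0Iso`, `groupCohomology.map_id_comp_H0Iso_hom`, and `heckeFun_constOne`).
[folklore] -/
theorem heckeEnd_H0Iso_inv_constOne {g : 𝒢} (hfin : (doubleCosetQuot L g).Finite) :
    heckeEnd k L g k ι 0
        ((groupCohomology.H0Iso (coeffRep k ι L k)).inv
          ⟨fun _ => (1 : k), constOne_mem_invariants k ι L⟩) =
      (hfin.toFinset.card : k) •
        (groupCohomology.H0Iso (coeffRep k ι L k)).inv
          ⟨fun _ => (1 : k), constOne_mem_invariants k ι L⟩ := by
  set A := coeffRep k ι L k with hA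
  set e := groupCohomology.H0Iso A with he
  set x₁ : A.ρ.invariants := ⟨fun _ => (1 : k), constOne_mem_invariants k ι L⟩ with hx₁
  -- the Hecke operator on the invariant vector `1`
  have hx : (Rep.invariantsFunctor k Γ).map (heckeRepHom k L g k ι) x₁ =
      (hfin.toFinset.card : k) • x₁ := by
    apply Subtype.ext
    change heckeFun k L g k (fun _ : 𝒢 ⧸ L => (1 : k)) = (hfin.toFinset.card : k) • fun _ => (1 : k)
    rw [heckeFun_constOne k L hfin]
    funext c
    simp
  -- naturality of `H0Iso`, evaluated at `e.inv x₁`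
  have hnat := groupCohomology.map_id_comp_H0Iso_hom (heckeRepHom k L g k ι)
  have h1 : e.hom (groupCohomology.map (MonoidHom.id Γ) (heckeRepHom k L g k ι) 0 (e.inv x₁)) =
      (hfin.toFinset.card : k) • x₁ := by
    have h2 := ConcreteCategory.congr_hom hnat (e.inv x₁)
    rw [ConcreteCategory.comp_apply, ConcreteCategory.comp_apply] at h2
    rw [h2]
    change (Rep.invariantsFunctor k Γ).map (heckeRepHom k L g k ι) (e.hom (e.inv x₁)) = _
    rw [Iso.inv_hom_id_apply, hx]
  -- apply `e.inv`
  have h3 := congrArg e.inv h1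
  rw [Iso.hom_inv_id_apply, map_smul] at h3
  exact h3

/-- The degree-`0` class `[1]` is nonzero as soon as `k` is nontrivial (its value at the coset `L`
is `1 ≠ 0`). [folklore] -/
theorem H0Iso_inv_constOne_ne_zero [Nontrivial k] :
    (groupCohomology.H0Iso (coeffRep k ι L k)).inv
        ⟨fun _ => (1 : k), constOne_mem_invariants k ι L⟩ ≠ 0 := by
  intro h
  have h1 := congrArg (groupCohomology.H0Iso (coeffRep k ι L k)).hom h
  rw [Iso.inv_hom_id_apply, map_zero] at h1
  have h2 := congrArg (fun f : (coeffRepresentation k ι L k).invariants =>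
    (f : (𝒢 ⧸ L) → k) ((1 : 𝒢) : 𝒢 ⧸ L)) h1
  exact one_ne_zero (h2.trans rfl)

end ArithmeticQuotient

/-! ### The eigenclass `[1] ∈ H⁰(X(M), F)` of [Ash2003]'s Hecke module -/

namespace Ash2003

/-- **The constant function is a Hecke eigenclass in `H⁰(X(M), F)`** (`M ≠ 0`, any field `F`): there
is a nonzero `α ∈ H⁰(X(M), F)` (`Ash2003.cohomology (p-1) (pN) F 0` in the fact) with
`T_{l,k} α = #(K_f(M) s_{l,k} K_f(M) / K_f(M)) · α` for every finite place and every `k` — in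
particular an `Ash2003.IsEigenclass` with these (reduced) counts as eigenvalues.  The double cosets
are finite by `finite_doubleCosetQuot_finiteLevel` (`K_f(M)` compact open).  This is the automorphic
side of the case `θ = 1` of [Ash2003, Thm. 1.1] up to the evaluation of the counts (Gaussian
binomials, not here). [cite: Ash2003, §2 and Def. 0.1] -/
theorem exists_isEigenclass_zero (n : ℕ) {M : ℕ} (hM : M ≠ 0) (F : Type) [Field F] :
    ∃ α : cohomology n M F 0,
      IsEigenclass n M F 0 α fun v k =>
        ((finite_doubleCosetQuot_finiteLevel n hM (heckeElement n v k)).toFinset.card : F) := by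
  refine ⟨(groupCohomology.H0Iso (ArithmeticQuotient.coeffRep F (posDetToFiniteAdelic n)
      (finiteLevel n M) F)).inv
    ⟨fun _ => (1 : F), ArithmeticQuotient.constOne_mem_invariants F (posDetToFiniteAdelic n)
      (finiteLevel n M)⟩, ?_, fun v _ k _ => ?_⟩
  · exact ArithmeticQuotient.H0Iso_inv_constOne_ne_zero F (posDetToFiniteAdelic n) (finiteLevel n M)
  · exact ArithmeticQuotient.heckeEnd_H0Iso_inv_constOne F (posDetToFiniteAdelic n) (finiteLevel n M)
      (finite_doubleCosetQuot_finiteLevel n hM (heckeElement n v k))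

end Ash2003

end Literature.NumberTheory.Automorphic
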